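import Literature.Probability.RandomPlanarGeometry.ProfileCollar
import Mathlib.Analysis.Normed.Module.FiniteDimension
import Mathlib.Topology.MetricSpace.Thickening
import HarnessLib

/-!
# Sandwich position of a profile collar domain

Topic `Literature/Probability/RandomPlanarGeometry`; family `conformal-planar`. Continuation of
`ProfileCollar.lean`: `D` is a Jordan domain with tube data `T`, `p` a continuous `1`-periodic
profile with values in `(0, 2)`, and `D'` a Jordan domain whose frontier is the trace of the
profile loop `t ↦ tube (p t) t`, containing the centre `z₀`. We prove the abstract form of the
"sandwich position" of the comparison domains of Bollobás–Riordan, *Percolation* (2006), Ch. 7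
p. 186 (Fig. 14) and (28)–(29) p. 192, relative to a splitting `∂D ⊆ A ∪ B` of the boundary into an
"allowed" part `A` (the arcs across which `D'` pokes out) and a "banned" part `B` (the arcs along
which `D'` is pushed in):

* `sandwich_of_frontier_eq`: if the boundary points `∂D(t)` at the parameters where the profile is
  not low (`p t > 1 - h'`) lie in a set `K ⊆ A` at distance `≥ d₀` from `B`, the deep tube levels
  `s ≤ 1 - h'` are `mi`-far from `∂D`, and the tube levels used are `tol`-close (resp. `tolθ`-close
  above level `1`) to `∂D`, then every point of the `r`-fattening of `D'` off `D` is within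
  `tolθ + 4 r` of `A`, and every point of it in `D` is at distance `≥ min mi (d₀ - tol) - 2 r` from
  `B`;
* `cap_of_subset_image`: a set `C` of tube points at an exterior level `1 + θ'` over parameters
  whose boundary points lie in `A₀` has its `r`-fattening off `D` and within `tolθ + 2 r` of `A₀`;
* `exists_trapezoid_profile`: the piecewise-linear two-plateau profiles used for the comparison
  rectangles (high plateau `1 + θ` on two parameter ranges, low plateau `1 - h` elsewhere, ramps
  of width `s/2`), with the localisation of their non-low set.

## References

* B. Bollobás, O. Riordan, *Percolation*, Cambridge University Press (2006), Ch. 7 pp. 186, 192.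

## Mathlib / tree

Mathlib: `Metric.cthickening_subset_iUnion_closedBall_of_lt`,
`exists_mem_frontier_infDist_compl_eq_dist`, `ContinuousOn.comp_fract''`. Tree: `ProfileCollar`
(`exists_eq_tube_of_mem_of_not_mem'`, `exists_eq_tube_of_mem_of_mem''`), `ConformalTube`.
-/

noncomputable section

open Set Metric Topology Filter Bornology

namespace Literature.Probability.RandomPlanarGeometry

/-- A point of the closed `r`-fattening of a set is within `2 r` of a point of the set (`r > 0`).
[folklore] -/
theorem exists_dist_le_two_mul_of_mem_cthickening {E : Set ℂ} {r : ℝ} (hr : 0 < r) {z : ℂ} (hz : z ∈ cthickening r E) :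
    ∃ x ∈ E, dist z x ≤ 2 * r := by
  have := cthickening_subset_iUnion_closedBall_of_lt E (by linarith : 0 < 2 * r) (by linarith : r < 2 * r) hz
  obtain ⟨x, hx, hzx⟩ := mem_iUnion₂.1 this
  exact ⟨x, hx, mem_closedBall.1 hzx⟩

namespace JordanDomain

namespace TubeData

variable {D : JordanDomain} (T : D.TubeData) {p : ℝ → ℝ} (hper : Function.Periodic p 1) (hp0 : ∀ u, 0 < p u) (hp2 : ∀ u, p u < 2)
  (D' : JordanDomain) (hD' : frontier D'.carrier = range fun u => T.tube (p u) u)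

include hper hp0 hp2 hD' in
/-- **Sandwich position of a profile collar domain** (abstract form of Bollobás–Riordan's
(28)–(29)). Let `∂D ⊆ A ∪ B` with `B ⊆ ∂D`; suppose the boundary points `∂D(t)` at the non-low
parameters (`p t > 1 - h'`) lie in a set `K ⊆ A` all of whose points are at distance `≥ d₀` from
`B`, the inner tube levels `0 ≤ s ≤ 1 - h'` are `mi`-far from `∂D`, the levels
`1 - h' ≤ s ≤ 1 + θ` (`p ≤ 1 + θ`) are `tol`-close and the levels `1 ≤ s ≤ 1 + θ` are `tolθ`-close to
`∂D(t)`, and `2 r < mi`, `tol + 2 r < d₀`. Then every point of the closed `r`-fattening of `D'`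
off `D` is within `tolθ + 4 r` of `A`, and every point of it in `D` is at distance
`≥ min mi (d₀ - tol) - 2 r` from every point of `B`. [cite: BollobasRiordan2006, Ch. 7 (28)–(29) p. 192] -/
theorem sandwich_of_frontier_eq {A B K : Set ℂ} {h' θ tol tolθ d₀ mi r : ℝ} (hθ : 0 ≤ θ) (hh' : 0 < h')
    (hhi : ∀ u, p u ≤ 1 + θ)
    (hK : ∀ t, 1 - h' < p t → D.boundary t ∈ K) (hKA : K ⊆ A) (hKB : ∀ k ∈ K, ∀ b ∈ B, d₀ ≤ dist k b)
    (hAB : frontier D.carrier ⊆ A ∪ B) (hB : B ⊆ frontier D.carrier)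
    (hmi : ∀ s t, 0 ≤ s → s ≤ 1 - h' → mi ≤ infDist (T.tube s t) (frontier D.carrier))
    (htol : ∀ s t, 1 - h' ≤ s → s ≤ 1 + θ → dist (T.tube s t) (D.boundary t) < tol)
    (htolθ : ∀ s t, 1 ≤ s → s ≤ 1 + θ → dist (T.tube s t) (D.boundary t) < tolθ)
    (hr : 0 < r) (hr1 : 2 * r < mi) (hr2 : tol + 2 * r < d₀) :
    (∀ z ∈ cthickening r D'.carrier, z ∉ D.carrier → ∃ a ∈ A, dist z a < tolθ + 4 * r) ∧
    (∀ z ∈ cthickening r D'.carrier, z ∈ D.carrier → ∀ b ∈ B, min mi (d₀ - tol) - 2 * r ≤ dist z b) := by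
  -- points of `D'` off `D`: near a point of `K`
  have key_out : ∀ x ∈ D'.carrier, x ∉ D.carrier →
      ∃ t, D.boundary t ∈ K ∧ dist x (D.boundary t) < tolθ ∧ dist x (D.boundary t) < tol := by
    intro x hx hxΩ
    obtain ⟨s, t, hs1, hsp, rfl⟩ := T.exists_eq_tube_of_mem_of_not_mem' hper hp0 hp2 D' hD' hx hxΩ
    have hpt := hhi t
    exact ⟨t, hK t (by linarith), htolθ s t hs1 (by linarith), htol s t (by linarith) (by linarith)⟩
  -- points of `D'` in `D`: far from `B`
  have key_in : ∀ x ∈ D'.carrier, x ∈ D.carrier → ∀ b ∈ B, min mi (d₀ - tol) ≤ dist x b := by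
    intro x hx hxΩ b hb
    obtain ⟨s, t, hs0, hs1, hsp, rfl⟩ := T.exists_eq_tube_of_mem_of_mem'' hper hp0 hp2 D' hD' hx hxΩ
    rcases le_or_gt s (1 - h') with hdeep | hshallow
    · exact (min_le_left _ _).trans ((hmi s t hs0 hdeep).trans (infDist_le_dist_of_mem (hB hb)))
    · have h1 := hKB _ (hK t (by linarith)) b hb
      have h2 := htol s t hshallow.le (by linarith)
      have h3 := dist_triangle (D.boundary t) (T.tube s t) b
      rw [dist_comm] at h2
      exact (min_le_right _ _).trans (by linarith)
  have htolθ0 : 0 < tolθ := dist_nonneg.trans_lt (htolθ 1 0 le_rfl (by linarith))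
  refine ⟨fun z hz hzΩ => ?_, fun z hz hzΩ b hb => ?_⟩
  · obtain ⟨x, hx, hzx⟩ := exists_dist_le_two_mul_of_mem_cthickening hr hz
    by_cases hxΩ : x ∈ D.carrier
    · -- `x ∈ D`, `z ∉ D`: a frontier point `y` within `2 r` of `x`
      obtain ⟨y, hy, hyd⟩ := exists_mem_frontier_infDist_compl_eq_dist hxΩ D.carrier_ne_univ
      have hxy : dist x y ≤ 2 * r := by
        rw [← hyd]; exact (infDist_le_dist_of_mem (mem_compl hzΩ)).trans (by rwa [dist_comm])
      rcases hAB hy with hyA | hyB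
      · exact ⟨y, hyA, by linarith [dist_triangle z x y]⟩
      · exfalso
        have := key_in x hx hxΩ y hyB
        have h4 : 2 * r < min mi (d₀ - tol) := lt_min hr1 (by linarith)
        linarith
    · obtain ⟨t, htK, htθ, -⟩ := key_out x hx hxΩ
      exact ⟨_, hKA htK, by linarith [dist_triangle z x (D.boundary t)]⟩
  · obtain ⟨x, hx, hzx⟩ := exists_dist_le_two_mul_of_mem_cthickening hr hz
    by_cases hxΩ : x ∈ D.carrier
    · have := key_in x hx hxΩ b hb
      linarith [dist_triangle x z b, dist_comm x z]
    · obtain ⟨t, htK, -, ht⟩ := key_out x hx hxΩ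
      have h1 := hKB _ htK b hb
      have h3 := dist_triangle4 (D.boundary t) x z b
      rw [dist_comm] at ht hzx
      exact le_trans (by linarith [min_le_right mi (d₀ - tol)]) (le_refl (dist z b))

omit hper hp0 hp2 hD' in
/-- **A pushed-out cap lies off `D`, near the arc it caps**: if `C` consists of tube points at an
exterior level `1 + θ'` (which is `mo`-far from `closure D` and `tolθ`-close to `∂D`) over
parameters whose boundary points lie in `A₀`, then the `r`-fattening of `C` (`2 r < mo`) misses
`D` and is within `tolθ + 2 r` of `A₀`. [cite: BollobasRiordan2006, Ch. 7 p. 186] -/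
theorem cap_of_subset_image {θ' mo tolθ r : ℝ}
    (hmo : ∀ t, mo ≤ infDist (T.tube (1 + θ') t) (closure D.carrier))
    (htolθ : ∀ t, dist (T.tube (1 + θ') t) (D.boundary t) < tolθ)
    {I : Set ℝ} {A₀ C : Set ℂ} (hI : ∀ t ∈ I, D.boundary t ∈ A₀) (hC : C ⊆ (fun t => T.tube (1 + θ') t) '' I)
    (hr : 0 < r) (hr1 : 2 * r < mo) :
    ∀ z ∈ cthickening r C, z ∉ D.carrier ∧ ∃ a ∈ A₀, dist z a < tolθ + 2 * r := by
  intro z hz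
  obtain ⟨x, hx, hzx⟩ := exists_dist_le_two_mul_of_mem_cthickening hr hz
  obtain ⟨t, ht, rfl⟩ := hC hx
  refine ⟨fun hzΩ => ?_, ⟨_, hI t ht, by linarith [dist_triangle z (T.tube (1 + θ') t) (D.boundary t), htolθ t]⟩⟩
  have := (hmo t).trans (infDist_le_dist_of_mem (subset_closure hzΩ))
  rw [dist_comm] at this
  linarith

end TubeData

end JordanDomain

/-! ### Trapezoid profiles -/

/-- **Two-plateau trapezoid profiles.** Given a window `a₀ < a₁ ≤ a₂ < a₃ ≤ a₀ + 1` with room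
`s` (`a₀ + s ≤ a₁`, `a₂ + s ≤ a₃`), a depth `h > 0` and a height `0 < θ ≤ h`, there is a
continuous `1`-periodic profile with values in `[1 - h, 1 + θ]`, equal to `1 + θ` on
`[a₀ + s/2, a₁ - s/2] ∪ [a₂ + s/2, a₃ - s/2]`, and whose non-low set `{p > 1 - h/2}` reduces, modulo
`1`, into `(a₀ + s/8, a₁ - s/8) ∪ (a₂ + s/8, a₃ - s/8)`. (Piecewise linear: ramps of width `s/2`
at the four ends, low plateau `1 - h` on `[a₁, a₂] ∪ [a₃, a₀ + 1]`.) [folklore] -/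
theorem exists_trapezoid_profile {a₀ a₁ a₂ a₃ s h θ : ℝ} (h01 : a₀ + s ≤ a₁) (h12 : a₁ ≤ a₂)
    (h23 : a₂ + s ≤ a₃) (h30 : a₃ ≤ a₀ + 1) (hs : 0 < s) (hh : 0 < h) (hθ : 0 < θ) (hθh : θ ≤ h) :
    ∃ p : ℝ → ℝ, Continuous p ∧ Function.Periodic p 1 ∧ (∀ u, 1 - h ≤ p u ∧ p u ≤ 1 + θ) ∧
      (∀ u ∈ Icc (a₀ + s / 2) (a₁ - s / 2) ∪ Icc (a₂ + s / 2) (a₃ - s / 2), p u = 1 + θ) ∧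
      (∀ u, 1 - h / 2 < p u →
        a₀ + Int.fract (u - a₀) ∈ Ioo (a₀ + s / 8) (a₁ - s / 8) ∪ Ioo (a₂ + s / 8) (a₃ - s / 8)) := by
  -- the trapezoid of height `1` on `[a, b]` with ramps of width `s/2`
  set trap : ℝ → ℝ → ℝ → ℝ := fun a b x => max 0 (min 1 (min (2 * (x - a) / s) (2 * (b - x) / s))) with htrap
  have trap_cont : ∀ a b, Continuous (trap a b) := fun a b => by simp only [htrap]; fun_prop
  have trap_nonneg : ∀ a b x, 0 ≤ trap a b x := fun a b x => le_max_left _ _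
  have trap_le_one : ∀ a b x, trap a b x ≤ 1 := fun a b x => max_le zero_le_one (min_le_left _ _)
  have trap_zero : ∀ a b x, x ≤ a ∨ b ≤ x → trap a b x = 0 := fun a b x hx => by
    refine max_eq_left ((min_le_right _ _).trans ?_)
    rcases hx with hx | hx
    · exact (min_le_left _ _).trans (div_nonpos_of_nonpos_of_nonneg (by linarith) hs.le)
    · exact (min_le_right _ _).trans (div_nonpos_of_nonpos_of_nonneg (by linarith) hs.le)
  have trap_one : ∀ a b x, a + s / 2 ≤ x → x ≤ b - s / 2 → trap a b x = 1 := fun a b x h1 h2 => by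
    refine (max_eq_right (le_min zero_le_one (le_min ?_ ?_))).trans (min_eq_left (le_min ?_ ?_)) <;>
      first | exact div_nonneg (by linarith) hs.le | (rw [le_div_iff₀ hs]; linarith)
  have trap_gt : ∀ a b x, 1 / 4 < trap a b x → a + s / 8 < x ∧ x < b - s / 8 := fun a b x hx => by
    have h1 : 1 / 4 < min (2 * (x - a) / s) (2 * (b - x) / s) := by
      have hx' : 1 / 4 < max 0 (min 1 (min (2 * (x - a) / s) (2 * (b - x) / s))) := hx
      rcases lt_max_iff.1 hx' with h0 | h0
      · linarith
      · exact h0.trans_le (min_le_right _ _)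
    have h2 := h1.trans_le (min_le_left _ _)
    have h3 := h1.trans_le (min_le_right _ _)
    rw [lt_div_iff₀ hs] at h2 h3
    constructor <;> linarith
  -- the profile on the window and its periodisation
  set g : ℝ → ℝ := fun x => 1 - h + (h + θ) * (trap a₀ a₁ x + trap a₂ a₃ x) with hg
  have hg_ends : g a₀ = g (a₀ + 1) := by
    simp only [hg, trap_zero a₀ a₁ a₀ (Or.inl le_rfl), trap_zero a₂ a₃ a₀ (Or.inl (by linarith)),
      trap_zero a₀ a₁ (a₀ + 1) (Or.inr (by linarith)), trap_zero a₂ a₃ (a₀ + 1) (Or.inr h30)]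
  have hsum : ∀ x, 0 ≤ trap a₀ a₁ x + trap a₂ a₃ x ∧ trap a₀ a₁ x + trap a₂ a₃ x ≤ 1 := fun x => by
    refine ⟨add_nonneg (trap_nonneg _ _ _) (trap_nonneg _ _ _), ?_⟩
    rcases le_or_gt x a₁ with hx | hx
    · rw [trap_zero a₂ a₃ x (Or.inl (by linarith)), add_zero]; exact trap_le_one _ _ _
    · rw [trap_zero a₀ a₁ x (Or.inr hx.le), zero_add]; exact trap_le_one _ _ _
  refine ⟨fun u => g (a₀ + Int.fract (u - a₀)), ?_, fun u => ?_, fun u => ?_, ?_, fun u hu => ?_⟩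
  · have hF : Continuous ((fun x => g (a₀ + x)) ∘ Int.fract) := by
      refine ContinuousOn.comp_fract'' (Continuous.continuousOn (by simp only [hg]; fun_prop)) ?_
      simp only [add_zero]; exact hg_ends
    exact hF.comp (continuous_id.sub continuous_const)
  · simp only [show u + 1 - a₀ = u - a₀ + 1 by ring, Int.fract_add_one]
  · have := hsum (a₀ + Int.fract (u - a₀))
    simp only [hg]
    constructor <;> nlinarith [this.1, this.2]
  · rintro u (⟨hu1, hu2⟩ | ⟨hu1, hu2⟩)
    · have hfr : Int.fract (u - a₀) = u - a₀ := Int.fract_eq_self.2 ⟨by linarith, by linarith⟩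
      simp only [hfr, add_sub_cancel, hg, trap_one a₀ a₁ u hu1 hu2, trap_zero a₂ a₃ u (Or.inl (by linarith))]
      ring
    · have hfr : Int.fract (u - a₀) = u - a₀ := Int.fract_eq_self.2 ⟨by linarith, by linarith⟩
      simp only [hfr, add_sub_cancel, hg, trap_zero a₀ a₁ u (Or.inr (by linarith)), trap_one a₂ a₃ u hu1 hu2]
      ring
  · set x := a₀ + Int.fract (u - a₀) with hx
    have hq : 1 / 4 < trap a₀ a₁ x + trap a₂ a₃ x := by
      simp only [hg] at hu
      by_contra hle
      push Not at hle
      nlinarith [hle, (hsum x).1]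
    rcases le_or_gt x a₁ with hx1 | hx1
    · rw [trap_zero a₂ a₃ x (Or.inl (by linarith)), add_zero] at hq
      exact Or.inl (trap_gt a₀ a₁ x hq)
    · rw [trap_zero a₀ a₁ x (Or.inr hx1.le), zero_add] at hq
      exact Or.inr (trap_gt a₂ a₃ x hq)

end Literature.Probability.RandomPlanarGeometry
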